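import Mathlib

/-!
# The sector-gap (Landau) door: a mode's occupation is bounded by the Wagner sum rule over the
particle-addition/removal gaps

Conjunct `BoseEinsteinCondensation` of `AtomisticToContinuum` — soloist report `paper/sharpest.md`
§4.9 (form (ML-SG) of the missing lemma).  Kernel form of the operator inequality behind it.

Setting (abstract): a complex inner product space `E` (think: Fock space, or the direct sum of the
`N-1`, `N`, `N+1`-particle sectors), a symmetric linear map `H` (the Hamiltonian), a pair of
mutually adjoint linear maps `a`, `adag` (annihilation / creation of one mode `φ`, `‖φ‖ = 1`),
and a normalised eigenvector `Ψ` of `H` with real eigenvalue `E₀` on which the canonical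
commutation relation `a adag Ψ = adag a Ψ + Ψ` holds.  Write `n := ‖a Ψ‖²` (the occupation
`⟨φ, γ_Ψ φ⟩` of the mode) and

  `D := re ⟨Ψ, [a, [H, adag]] Ψ⟩ = re ⟨Ψ, (a H adag − a adag H − H adag a + adag H a) Ψ⟩`

(the first moment of the one-particle spectral function: the Wagner sum rule,
[Wagner1966; Griffin1993 (4.5); Stringari1995 §2]); below `D` is always written out as this
explicit real part.

* `SoloInformed.doubleCommutator_eq` — the **sum-rule identity**
  `D = re⟨adag Ψ, H adag Ψ⟩ + re⟨a Ψ, H a Ψ⟩ − E₀ (‖adag Ψ‖² + ‖a Ψ‖²)`;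
* `SoloInformed.norm_sq_adag_eq` — `‖adag Ψ‖² = ‖a Ψ‖² + ‖Ψ‖²` (CCR on `Ψ`);
* `SoloInformed.two_mul_occupation_add_one_mul_gap_le` — the symmetric form `(2n+1)Δ₀ ≤ D` when
  both sectors lie `Δ₀` above `E₀` (Pitaevskii–Stringari-type);
* `SoloInformed.occupation_mul_sectorGap_le` — the **door**: if `H ≥ E₊` on the vector `adag Ψ`
  and `H ≥ E₋` on the vector `a Ψ` (variational principle in the sectors reached by adding /
  removing the mode — for a translation-invariant Bose gas and `φ = φ_k` these are the
  `(N+1, k)` and `(N−1, −k)` particle-number/momentum sectors), then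
  `(E₊ + E₋ − 2E₀) · n ≤ D − (E₊ − E₀)`;
* `SoloInformed.occupation_le_div_sectorGap` — hence `n ≤ (D − (E₊ − E₀)) / (E₊ + E₋ − 2E₀)`
  when the sector gap `Δ := E₊ + E₋ − 2E₀` is positive.

Remarks on sharpness: the sector infima are in general attained by multi-particle (multi-phonon)
states — the subadditive hull of the one-excitation dispersion.  For the ideal gas on the torus
(`k = (2π/L)m`, `E₀(N±1,k) − E₀(N) = (2π/L)|k|₁`) the bound reads `n_k ≤ (|m|₂² − |m|₁)/(2|m|₁)`:
equality (`n_k = 0`) exactly at the lowest momenta `|m|₁ = 1`, and `Δ_k → 0` with `L` (no Landau bound,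
as it must be).  For the dilute interacting gas, with `ε(k) ≈ c|k|` the linear hull of the Bogoliubov
dispersion, the bound is Bogoliubov's `v_k² ≈ ρg/(2c|k|)` to leading order as `kξ → 0`.  With
`D_k ≤ k² + 2ρ‖v‖₁` and a Landau-type lower bound `Δ_k ≥ 2c√(ρa)|k|` on a momentum window,
summing the door over the window and the kinetic energy over its complement gives complete BEC
in the dilute three-dimensional gas (report §4.9); the Landau bound itself is open
(Cornean–Dereziński–Ziń 2009, Conjecture 1.1(3)).

References: H. Wagner, Z. Physik 195 (1966) 273; A. Griffin, *Excitations in a Bose-condensed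
liquid* (1993), eq. (4.5); S. Stringari, in *Bose–Einstein Condensation* (Griffin–Snoke–Stringari
eds., 1995), pp. 86–98, §2; H. D. Cornean, J. Dereziński, P. Ziń, J. Math. Phys. 50 (2009) 062103,
arXiv:math-ph/0511007, Conjecture 1.1.
-/

noncomputable section

open Complex
open scoped InnerProductSpace ComplexConjugate

namespace Summit.AtomisticToContinuum.BoseEinsteinCondensation.Theorems

universe v

variable {E : Type v} [NormedAddCommGroup E] [InnerProductSpace ℂ E]

section Door

variable {H a adag : E →ₗ[ℂ] E} {Ψ : E} {E₀ : ℝ}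

/-- **CCR on the state**: `a a† Ψ = a† a Ψ + Ψ` gives `‖a† Ψ‖² = ‖a Ψ‖² + ‖Ψ‖²`, i.e.
`⟨a a†⟩ = n + 1` for a normalised state. [folklore] -/
theorem SoloInformed.norm_sq_adag_eq (hadj : ∀ x y : E, ⟪adag x, y⟫_ℂ = ⟪x, a y⟫_ℂ)
    (hCCR : a (adag Ψ) = adag (a Ψ) + Ψ) :
    ‖adag Ψ‖ ^ 2 = ‖a Ψ‖ ^ 2 + ‖Ψ‖ ^ 2 := by
  have nsq : ∀ x : E, ‖x‖ ^ 2 = (⟪x, x⟫_ℂ).re := fun x => by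
    rw [← inner_self_eq_norm_sq (𝕜 := ℂ) x]; rfl
  have h1 : ⟪adag Ψ, adag Ψ⟫_ℂ = ⟪Ψ, a (adag Ψ)⟫_ℂ := hadj Ψ (adag Ψ)
  have h2 : ⟪Ψ, adag (a Ψ)⟫_ℂ = ⟪a Ψ, a Ψ⟫_ℂ := by
    rw [← inner_conj_symm, hadj (a Ψ) Ψ, inner_conj_symm]
  rw [nsq, nsq, nsq, h1, hCCR, inner_add_right, h2, Complex.add_re]

/-- **Sum-rule identity.** For a symmetric `H`, mutually adjoint `a`, `a†` and an eigenvector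
`H Ψ = E₀ Ψ` (`E₀` real):
`re⟨Ψ,[a,[H,a†]]Ψ⟩ = re⟨a†Ψ, H a†Ψ⟩ + re⟨aΨ, H aΨ⟩ − E₀(‖a†Ψ‖² + ‖aΨ‖²)`. [folklore] -/
theorem SoloInformed.doubleCommutator_eq (hH : ∀ x y : E, ⟪H x, y⟫_ℂ = ⟪x, H y⟫_ℂ)
    (hadj : ∀ x y : E, ⟪adag x, y⟫_ℂ = ⟪x, a y⟫_ℂ) (hΨ : H Ψ = (E₀ : ℂ) • Ψ) :
    (⟪Ψ, a (H (adag Ψ)) - a (adag (H Ψ)) - H (adag (a Ψ)) + adag (H (a Ψ))⟫_ℂ).re =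
      (⟪adag Ψ, H (adag Ψ)⟫_ℂ).re + (⟪a Ψ, H (a Ψ)⟫_ℂ).re
        - E₀ * (‖adag Ψ‖ ^ 2 + ‖a Ψ‖ ^ 2) := by
  have nsq : ∀ x : E, ‖x‖ ^ 2 = (⟪x, x⟫_ℂ).re := fun x => by
    rw [← inner_self_eq_norm_sq (𝕜 := ℂ) x]; rfl
  -- the four terms of the double commutator
  have t1 : ⟪Ψ, a (H (adag Ψ))⟫_ℂ = ⟪adag Ψ, H (adag Ψ)⟫_ℂ := (hadj Ψ (H (adag Ψ))).symm
  have t2 : ⟪Ψ, a (adag (H Ψ))⟫_ℂ = (E₀ : ℂ) * ⟪adag Ψ, adag Ψ⟫_ℂ := by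
    rw [← hadj Ψ (adag (H Ψ)), hΨ, map_smul, inner_smul_right]
  have t3 : ⟪Ψ, H (adag (a Ψ))⟫_ℂ = (E₀ : ℂ) * ⟪a Ψ, a Ψ⟫_ℂ := by
    have h2 : ⟪Ψ, adag (a Ψ)⟫_ℂ = ⟪a Ψ, a Ψ⟫_ℂ := by
      rw [← inner_conj_symm, hadj (a Ψ) Ψ, inner_conj_symm]
    rw [← hH Ψ (adag (a Ψ)), hΨ, inner_smul_left, Complex.conj_ofReal, h2]
  have t4 : ⟪Ψ, adag (H (a Ψ))⟫_ℂ = ⟪a Ψ, H (a Ψ)⟫_ℂ := by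
    rw [← inner_conj_symm, hadj (H (a Ψ)) Ψ, inner_conj_symm]
  rw [inner_add_right, inner_sub_right, inner_sub_right, t1, t2, t3, t4,
    Complex.add_re, Complex.sub_re, Complex.sub_re,
    Complex.re_ofReal_mul, Complex.re_ofReal_mul, nsq, nsq]
  ring

/-- **The sector-gap (Landau) door.** Let `H` be symmetric, `a`, `a†` mutually adjoint,
`H Ψ = E₀ Ψ` with `‖Ψ‖ = 1` and `a a† Ψ = a† a Ψ + Ψ`.  If the quadratic form of `H` is at least
`E₊` on the vector `a† Ψ` and at least `E₋` on `a Ψ` (the variational principle in the sectors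
reached by adding / removing the mode), then the occupation `n = ‖a Ψ‖²` obeys
`(E₊ + E₋ − 2E₀) n ≤ re⟨Ψ,[a,[H,a†]]Ψ⟩ − (E₊ − E₀)`.  Equality for the lowest modes of the ideal Bose
gas; Bogoliubov's `v_k²` to leading order at small `kξ` (see the module docstring).
[folklore; report §4.9 (4.9.2)] -/
theorem SoloInformed.occupation_mul_sectorGap_le {Ep Em : ℝ}
    (hH : ∀ x y : E, ⟪H x, y⟫_ℂ = ⟪x, H y⟫_ℂ)
    (hadj : ∀ x y : E, ⟪adag x, y⟫_ℂ = ⟪x, a y⟫_ℂ) (hΨ : H Ψ = (E₀ : ℂ) • Ψ) (hnorm : ‖Ψ‖ = 1)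
    (hCCR : a (adag Ψ) = adag (a Ψ) + Ψ)
    (hplus : Ep * ‖adag Ψ‖ ^ 2 ≤ (⟪adag Ψ, H (adag Ψ)⟫_ℂ).re)
    (hminus : Em * ‖a Ψ‖ ^ 2 ≤ (⟪a Ψ, H (a Ψ)⟫_ℂ).re) :
    (Ep + Em - 2 * E₀) * ‖a Ψ‖ ^ 2 ≤
      (⟪Ψ, a (H (adag Ψ)) - a (adag (H Ψ)) - H (adag (a Ψ)) + adag (H (a Ψ))⟫_ℂ).re - (Ep - E₀) := by
  have hid := SoloInformed.doubleCommutator_eq (E₀ := E₀) hH hadj hΨ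
  have hn : ‖adag Ψ‖ ^ 2 = ‖a Ψ‖ ^ 2 + 1 := by
    rw [SoloInformed.norm_sq_adag_eq hadj hCCR, hnorm, one_pow]
  rw [hid, hn]
  rw [hn] at hplus
  nlinarith [hplus, hminus, sq_nonneg ‖a Ψ‖]

/-- **Occupation bound from the sector gap**: with `Δ := E₊ + E₋ − 2E₀ > 0`,
`‖a Ψ‖² ≤ (re⟨Ψ,[a,[H,a†]]Ψ⟩ − (E₊ − E₀)) / Δ`.  For the translation-invariant Bose gas,
`φ = φ_k`: `n_k ≤ (D_k − (E₀(N+1,k) − E₀(N))) / (E₀(N+1,k) + E₀(N−1,k) − 2E₀(N))` with the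
Wagner sum rule `D_k = k² + ρ v̂(0) + L⁻³ Σ_q v̂(k−q) n_q ≤ k² + 2ρ‖v‖₁`. [report §4.9 (4.9.2)] -/
theorem SoloInformed.occupation_le_div_sectorGap {Ep Em : ℝ}
    (hH : ∀ x y : E, ⟪H x, y⟫_ℂ = ⟪x, H y⟫_ℂ)
    (hadj : ∀ x y : E, ⟪adag x, y⟫_ℂ = ⟪x, a y⟫_ℂ) (hΨ : H Ψ = (E₀ : ℂ) • Ψ) (hnorm : ‖Ψ‖ = 1)
    (hCCR : a (adag Ψ) = adag (a Ψ) + Ψ)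
    (hplus : Ep * ‖adag Ψ‖ ^ 2 ≤ (⟪adag Ψ, H (adag Ψ)⟫_ℂ).re)
    (hminus : Em * ‖a Ψ‖ ^ 2 ≤ (⟪a Ψ, H (a Ψ)⟫_ℂ).re) (hgap : 0 < Ep + Em - 2 * E₀) :
    ‖a Ψ‖ ^ 2 ≤ ((⟪Ψ, a (H (adag Ψ)) - a (adag (H Ψ)) - H (adag (a Ψ)) + adag (H (a Ψ))⟫_ℂ).re - (Ep - E₀)) / (Ep + Em - 2 * E₀) := by
  rw [le_div_iff₀ hgap, mul_comm]
  exact SoloInformed.occupation_mul_sectorGap_le hH hadj hΨ hnorm hCCR hplus hminus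

/-- **The symmetric (Pitaevskii–Stringari-type) form**: if both sectors lie at least `Δ₀ > 0`
above `E₀` then `(2n + 1) Δ₀ ≤ re⟨Ψ,[a,[H,a†]]Ψ⟩`, i.e. `⟨{a, a†}⟩ ≤ D/Δ₀` — the `T = 0`
combination of the uncertainty-type bound `⟨{A†,A}⟩² ≤ ⟨[A†,[H,A]]⟩ χ_A` with `χ_A ≤ ⟨{A†,A}⟩/Δ₀`.
[cite: Stringari1995, §2.2 (8)–(10)] -/
theorem SoloInformed.two_mul_occupation_add_one_mul_gap_le {Δ₀ : ℝ}
    (hH : ∀ x y : E, ⟪H x, y⟫_ℂ = ⟪x, H y⟫_ℂ)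
    (hadj : ∀ x y : E, ⟪adag x, y⟫_ℂ = ⟪x, a y⟫_ℂ) (hΨ : H Ψ = (E₀ : ℂ) • Ψ) (hnorm : ‖Ψ‖ = 1)
    (hCCR : a (adag Ψ) = adag (a Ψ) + Ψ)
    (hplus : (E₀ + Δ₀) * ‖adag Ψ‖ ^ 2 ≤ (⟪adag Ψ, H (adag Ψ)⟫_ℂ).re)
    (hminus : (E₀ + Δ₀) * ‖a Ψ‖ ^ 2 ≤ (⟪a Ψ, H (a Ψ)⟫_ℂ).re) :
    (2 * ‖a Ψ‖ ^ 2 + 1) * Δ₀ ≤ (⟪Ψ, a (H (adag Ψ)) - a (adag (H Ψ)) - H (adag (a Ψ)) + adag (H (a Ψ))⟫_ℂ).re := by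
  have h := SoloInformed.occupation_mul_sectorGap_le hH hadj hΨ hnorm hCCR hplus hminus
  nlinarith [h]

end Door

end Summit.AtomisticToContinuum.BoseEinsteinCondensation.Theorems

end
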